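import Literature.NumberTheory.Automorphic.UnitaryGroupDirectSum
import HarnessLib

/-!
# Isometries and relabellings of Gram matrices under re-enumeration, block-diagonal sums and negation

Generic `GL`/matrix algebra over commutative rings, in the vocabulary of ★ `UnitaryGroupDirectSum` (`reindexGL`, `blockDiagGL`):
for a ring map `σ` (the involution of a hermitian form) and Gram matrices `H`, `T`:

* `isometry_reindexGL` — `(σ ẽg)ᵀ (reindex H) ẽg = reindex ((σ g)ᵀ H g)` for `ẽg = reindexGL e g`;
* `isometry_neg` — an isometry of `H` is an isometry of `−H`; `isUnit_det_neg`;
* `isometry_blockDiagGL` — `diag(g₁, g₂)` carries `H₁ ⊕ H₂` to `H₁′ ⊕ H₂′`;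
* `reindex_mul_coe_reindexGL`, `fromBlocks_mul_coe_blockDiagGL` — the same for RELABELLINGS `T ↦ T C`;
* `map_mul_mul_inv_eq` — conjugation passes through a group homomorphism; `coe_reindexGL_blockDiagGL_map` — `map f` commutes with
  `reindexGL e₂ (blockDiagGL (g₁, g₂))`.

This is the change-of-frame / orthogonal-sum bookkeeping ([PlatonovRapinchuk1994, §2.3, §5.1]: transport of the unitary group of a form
along a change of basis and of scalars; [Kudla1984, §1]: see-saw pairs sit block-diagonally after an isometry; [MoeglinVignerasWaldspurger1987,
Chap. 1 I.17]: ε-hermitian spaces, orthogonal sums, the negated space) consumed by the doubled Kronecker conjugation datum of the GS-6 (β) glue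
(cell `hodgecm-mathlib`, node (T), (T1ᴰ) §1; consumer module `Literature/NumberTheory/GelbartRogawski1991/DoubledKroneckerConjugation.lean`
(§2–§4 of the model: `kronA`/`kronAD`/`relabC`/`relabCD`, `thetaD`, `seesawD`, `rD`); phase-A bytes of record
`A-plan/gs6-glue/T1D-modelInstantiation.A-p06g11.lean` v3 sha16 54c3fde381223f81 §1, A-p06 g11, declarations byte-identical up to the
`[folklore]` → `[cite:]` docstring tags).  Theorems only.

## References

* [PlatonovRapinchuk1994] V. Platonov, A. Rapinchuk, *Algebraic Groups and Number Theory*, Academic Press 1994, §2.3 (classical groups of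
  forms; change of basis), §5.1 (adelic points, base change).
* [Kudla1984] S. Kudla, *Seesaw dual reductive pairs*, Progr. Math. 46 (1984), §1.
* [MoeglinVignerasWaldspurger1987] C. Mœglin, M.-F. Vignéras, J.-L. Waldspurger, *Correspondances de Howe sur un corps p-adique*, LNM 1291
  (1987), Chap. 1 I.17.
-/

set_option autoImplicit false

section GenericAlgebra

open scoped Matrix
open Literature.NumberTheory.Automorphic.UnitaryGroup

namespace Literature.NumberTheory.Automorphic.UnitaryGroup

variable {R S : Type*} [CommRing R] [CommRing S] {m m' m₂ : Type*}

/-- **isometries re-enumerate**: `(σ ẽg)ᵀ (reindex H) ẽg = reindex ((σ g)ᵀ H g)` for `ẽg = reindexGL e g`. [cite: PlatonovRapinchuk1994, §2.3] -/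
theorem isometry_reindexGL [Fintype m] [Fintype m'] [DecidableEq m] [DecidableEq m'] (σ : S →+* S) (e : m ≃ m')
    {H H' : Matrix m m S} (g : GL m S)
    (hg : ((g : Matrix m m S).map σ)ᵀ * H * g = H') :
    (((reindexGL e g : GL m' S) : Matrix m' m' S).map σ)ᵀ * Matrix.reindex e e H * (reindexGL e g : GL m' S) =
      Matrix.reindex e e H' := by
  rw [coe_reindexGL, Matrix.reindex_apply, Matrix.reindex_apply, Matrix.reindex_apply, ← Matrix.submatrix_map,
    Matrix.transpose_submatrix, Matrix.submatrix_mul_equiv, Matrix.submatrix_mul_equiv, hg]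

/-- **isometries of `H` are isometries of `−H`**. [cite: MoeglinVignerasWaldspurger1987, Chap. 1 I.17] -/
theorem isometry_neg [Fintype m] (σ : S →+* S) {H H' g : Matrix m m S} (hg : (g.map σ)ᵀ * H * g = H') :
    (g.map σ)ᵀ * (-H) * g = -H' := by
  rw [Matrix.mul_neg, Matrix.neg_mul, hg]

/-- **block-diagonal isometries**: `diag(g₁, g₂)` carries `H₁ ⊕ H₂` to `H₁′ ⊕ H₂′`. [cite: Kudla1984, §1] -/
theorem isometry_blockDiagGL [Fintype m] [Fintype m₂] [DecidableEq m] [DecidableEq m₂] (σ : S →+* S) {H₁ H₁' : Matrix m m S} {H₂ H₂' : Matrix m₂ m₂ S} (g₁ : GL m S) (g₂ : GL m₂ S)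
    (h₁ : ((g₁ : Matrix m m S).map σ)ᵀ * H₁ * g₁ = H₁') (h₂ : ((g₂ : Matrix m₂ m₂ S).map σ)ᵀ * H₂ * g₂ = H₂') :
    (((blockDiagGL (g₁, g₂) : GL (m ⊕ m₂) S) : Matrix (m ⊕ m₂) (m ⊕ m₂) S).map σ)ᵀ * Matrix.fromBlocks H₁ 0 0 H₂ *
        (blockDiagGL (g₁, g₂) : GL (m ⊕ m₂) S) = Matrix.fromBlocks H₁' 0 0 H₂' := by
  rw [coe_blockDiagGL, Matrix.fromBlocks_map, Matrix.fromBlocks_transpose, Matrix.fromBlocks_multiply,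
    Matrix.fromBlocks_multiply]
  simp only [Matrix.map_zero σ (map_zero σ), Matrix.transpose_zero, Matrix.zero_mul, Matrix.mul_zero, add_zero, zero_add, h₁, h₂]

/-- **relabellings re-enumerate**: `reindex T · reindexGL e C = reindex (T C)`. [cite: PlatonovRapinchuk1994, §2.3] -/
theorem reindex_mul_coe_reindexGL [Fintype m] [Fintype m'] [DecidableEq m] [DecidableEq m'] (e : m ≃ m') (T : Matrix m m R)
    (C : GL m R) :
    Matrix.reindex e e T * ((reindexGL e C : GL m' R) : Matrix m' m' R) = Matrix.reindex e e (T * (C : Matrix m m R)) := by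
  rw [coe_reindexGL, Matrix.reindex_apply, Matrix.reindex_apply, Matrix.reindex_apply, Matrix.submatrix_mul_equiv]

/-- **block-diagonal relabellings**: `(T₁ ⊕ T₂) · diag(C₁, C₂) = T₁ C₁ ⊕ T₂ C₂`. [cite: Kudla1984, §1] -/
theorem fromBlocks_mul_coe_blockDiagGL [Fintype m] [Fintype m₂] [DecidableEq m] [DecidableEq m₂] (T₁ : Matrix m m R)
    (T₂ : Matrix m₂ m₂ R) (C₁ : GL m R) (C₂ : GL m₂ R) :
    Matrix.fromBlocks T₁ 0 0 T₂ * ((blockDiagGL (C₁, C₂) : GL (m ⊕ m₂) R) : Matrix (m ⊕ m₂) (m ⊕ m₂) R) =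
      Matrix.fromBlocks (T₁ * (C₁ : Matrix m m R)) 0 0 (T₂ * (C₂ : Matrix m₂ m₂ R)) := by
  rw [coe_blockDiagGL, Matrix.fromBlocks_multiply]
  simp only [Matrix.zero_mul, Matrix.mul_zero, add_zero, zero_add]

/-- `det (−M)` is a unit when `det M` is (the Gram matrix `−T` of the negated space). [cite: MoeglinVignerasWaldspurger1987, Chap. 1 I.17] -/
theorem isUnit_det_neg [Fintype m] [DecidableEq m] {M : Matrix m m R} (h : IsUnit M.det) : IsUnit (-M).det := by
  exact (Matrix.isUnit_iff_isUnit_det _).1 ((Matrix.isUnit_iff_isUnit_det _).2 h).neg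

/-- `f x · f y · (f x)⁻¹ = f (x y x⁻¹)` for a group homomorphism (conjugation passes through a change of frame). [cite: PlatonovRapinchuk1994, §2.3] -/
theorem map_mul_mul_inv_eq {G H : Type*} [Group G] [Group H] (f : G →* H) (x y : G) :
    f x * f y * (f x)⁻¹ = f (x * y * x⁻¹) := by
  rw [map_mul, map_mul, map_inv]

/-- the matrix of `reindexGL e₂ (blockDiagGL (g₁, g₂))` over a base change: `map f` commutes with both. [cite: PlatonovRapinchuk1994, §5.1] -/
theorem coe_reindexGL_blockDiagGL_map [Fintype m] [Fintype m'] [Fintype m₂] [DecidableEq m] [DecidableEq m'] [DecidableEq m₂]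
    {S' : Type*} [CommRing S'] (f : S →+* S') (e : m ⊕ m₂ ≃ m')
    (g₁ : GL m S) (g₂ : GL m₂ S) {g₁' : GL m S'} {g₂' : GL m₂ S'}
    (h₁ : (g₁' : Matrix m m S') = (g₁ : Matrix m m S).map f) (h₂ : (g₂' : Matrix m₂ m₂ S') = (g₂ : Matrix m₂ m₂ S).map f) :
    ((reindexGL e (blockDiagGL (g₁', g₂')) : GL m' S') : Matrix m' m' S') =
      ((reindexGL e (blockDiagGL (g₁, g₂)) : GL m' S) : Matrix m' m' S).map f := by
  simp only [coe_reindexGL, coe_blockDiagGL, reindex_map, Matrix.fromBlocks_map, h₁, h₂, Matrix.map_zero f (map_zero f)]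

end Literature.NumberTheory.Automorphic.UnitaryGroup

end GenericAlgebra
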